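import Mathlib
import Summits.NavierStokesRegularity.NavierStokesRegularity.Theorems.EulerZoomLiouvillePowerGaugeEulerLiouvilleLastExitCofinalReturner
import HarnessLib

/-!
# Line `last_exit` (ns-idea-11 g8), stub LE2b `stub_lateReturnsVanish` — tools: the WINDOW BEFORE A RETURN and the IDENTIFICATION OF CUT-OFF ARCS
# (crux `EulerZoomLiouville.PowerGaugeEulerLiouville` = stmt-NavierStokesRegularity-19832; class-free ODE lemmas; width seat ns-ezl-w3 g6, plan of ns-ezl-w1 g6)

Route №10 `EulerZoomLiouville` (NavierStokesRegularity), crux E; line `Cruxes/PowerGaugeEulerLiouville/Lines/last_exit.lean` (LINE g8-2).  Two class-free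
lemmas for the measure bookkeeping of LE2b («late returns are rare»):

* `LastExit.norm_le_of_return_window` — THE WINDOW BEFORE A RETURN: if `‖W‖ ≤ v₁` on `B̄(0, R₁+1)`, `v₁δ < 1`, and a `W`-arc `Z` on `[0, σ]` (`σ ≥ δ`)
  is in `B(0,R₁)` at time `σ`, then `‖Z s‖ ≤ R₁ + 1` on the whole window `[σ − δ, σ]` (a sub-arc crossing the shell `R₁ < ‖·‖ < R₁+1` inward needs
  displacement `> 1` at speed `≤ v₁` within time `≤ δ`);
* `LastExit.eqOn_arcs_of_cutoff` — two `W_{V₀}`-arcs on `[0, σ]` of a globally Lipschitz `C¹` field `V₀` with the same initial point coincide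
  (`ODE_solution_unique`); used to identify the backward orbits of different cut-off copies of the profile while they stay where the copies agree.

WHAT THIS IS NOT: not NS regularity, not the crux E — ODE bookkeeping on the MODEL lattice, `--supports` stmt-19832; 19832 OPEN. [folklore]
-/

noncomputable section

-- flat `Theorems/<Route><Decl>…` files of one crux share the namespace of the crux (tree convention: `Summit.<S>.<S>.…`)
set_option linter.dupNamespace false

open Set Filter Topology Metric MeasureTheory
open scoped RealInnerProductSpace ENNReal

namespace Summit.NavierStokesRegularity.NavierStokesRegularity.Theorems.PowerGaugeEulerLiouville

namespace LastExit

open Literature.Analysis Literature.Analysis.FluidPDE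
open ChannelClock

variable {γ : ℝ} {V : EuclideanSpace ℝ (Fin 3) → EuclideanSpace ℝ (Fin 3)}

/-- **THE WINDOW BEFORE A RETURN.**  Let `W = γy + V` be continuous with `‖W z‖ ≤ v₁` for `‖z‖ ≤ R₁ + 1`, `δ > 0` with `v₁δ < 1`, and let `Z` be a
`W`-arc on `[0, σ]` (`Z′ = −W(Z)`), `σ ≥ δ`, with `‖Z σ‖ < R₁`.  Then `‖Z s‖ ≤ R₁ + 1` for all `s ∈ [σ − δ, σ]`. [folklore] -/
theorem norm_le_of_return_window (hWc : Continuous (selfSimilarTransport γ 0 V)) {v₁ R₁ δ : ℝ}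
    (hv₁ : ∀ z : EuclideanSpace ℝ (Fin 3), ‖z‖ ≤ R₁ + 1 → ‖selfSimilarTransport γ 0 V z‖ ≤ v₁)
    (hv₁δ : v₁ * δ < 1) {Z : ℝ → EuclideanSpace ℝ (Fin 3)} {σ : ℝ} (hδσ : δ ≤ σ)
    (hZ : ∀ s ∈ Icc 0 σ, HasDerivAt Z (-(selfSimilarTransport γ 0 V (Z s))) s) (hret : ‖Z σ‖ < R₁) :
    ∀ s ∈ Icc (σ - δ) σ, ‖Z s‖ ≤ R₁ + 1 := by
  intro s hs
  by_contra hgt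
  push Not at hgt
  have hs0 : 0 ≤ s := by linarith [hs.1]
  have hZc : ContinuousOn Z (Icc 0 σ) := fun t ht => (hZ t ht).continuousAt.continuousWithinAt
  -- first hit of the level `R₁ + 1` by the reversed radius `u ↦ ‖Z (σ − u)‖` on `[0, σ − s]`
  set f : ℝ → ℝ := fun u => ‖Z (σ - u)‖ with hfdef
  have hfc : ContinuousOn f (Icc 0 (σ - s)) := by
    have h1 : ContinuousOn (fun u : ℝ => Z (σ - u)) (Icc 0 (σ - s)) := by
      refine hZc.comp (continuous_const.sub continuous_id).continuousOn fun u hu => ?_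
      exact ⟨by linarith [hu.2], by linarith [hu.1]⟩
    exact h1.norm
  have hf0 : f 0 < R₁ + 1 := by simp only [hfdef, sub_zero]; linarith
  have hf1 : R₁ + 1 ≤ f (σ - s) := by simp only [hfdef, sub_sub_cancel]; exact hgt.le
  obtain ⟨u₁, hu₁pos, hu₁le, hu₁hit, hu₁in⟩ := exists_first_hit (f := f) (by linarith [hs.2]) hfc hf0 hf1
  set a : ℝ := σ - u₁ with hadef
  have ha0 : 0 ≤ a := by rw [hadef]; linarith
  have haσ : a ≤ σ := by rw [hadef]; linarith
  have hZa : ‖Z a‖ = R₁ + 1 := by have : f u₁ = R₁ + 1 := hu₁hit; simpa [hfdef, hadef] using this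
  have hinside : ∀ t ∈ Icc a σ, ‖Z t‖ ≤ R₁ + 1 := by
    intro t ht
    have hu : σ - t ∈ Icc 0 u₁ := ⟨by linarith [ht.2], by rw [hadef] at ht; linarith [ht.1]⟩
    have h := hu₁in (σ - t) hu
    simp only [hfdef, sub_sub_cancel] at h
    exact h
  -- displacement `‖Z σ − Z a‖ ≤ v₁ (σ − a) ≤ v₁ δ < 1`
  have hftc : ∫ t in a..σ, -(selfSimilarTransport γ 0 V (Z t)) = Z σ - Z a :=
    intervalIntegral.integral_eq_sub_of_hasDerivAt
      (fun t ht => by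
        rw [uIcc_of_le haσ] at ht
        exact hZ t ⟨ha0.trans ht.1, ht.2⟩)
      (by
        refine ContinuousOn.intervalIntegrable ?_
        rw [uIcc_of_le haσ]
        exact (hWc.comp_continuousOn (hZc.mono (Icc_subset_Icc ha0 le_rfl))).neg)
  have hdisp : ‖Z σ - Z a‖ ≤ v₁ * |σ - a| := by
    rw [← hftc]
    refine intervalIntegral.norm_integral_le_of_norm_le_const fun t ht => ?_
    rw [uIoc_of_le haσ] at ht
    rw [norm_neg]
    exact hv₁ _ (hinside t ⟨ht.1.le, ht.2⟩)
  have hσa : |σ - a| = u₁ := by rw [hadef, sub_sub_cancel, abs_of_pos hu₁pos]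
  have hu₁δ : u₁ ≤ δ := by linarith [hs.1]
  have hv₁0 : 0 ≤ v₁ := (norm_nonneg _).trans (hv₁ (Z a) hZa.le)
  have h1 : ‖Z σ - Z a‖ < 1 := by
    calc ‖Z σ - Z a‖ ≤ v₁ * |σ - a| := hdisp
      _ = v₁ * u₁ := by rw [hσa]
      _ ≤ v₁ * δ := mul_le_mul_of_nonneg_left hu₁δ hv₁0
      _ < 1 := hv₁δ
  have h2 : ‖Z a‖ - ‖Z σ‖ ≤ ‖Z σ - Z a‖ := by rw [norm_sub_rev]; exact norm_sub_norm_le _ _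
  rw [hZa] at h2
  linarith

/-- **Identification of arcs of one cut-off field**: two `W_{V₀}`-arcs on `[0, σ]` (`V₀` a `C¹` field with `‖DV₀‖ ≤ K₀`, so `W_{V₀} = γy + V₀` is
globally Lipschitz) with the same initial point coincide on `[0, σ]`. [folklore; Picard–Lindelöf uniqueness, Mathlib `ODE_solution_unique`] -/
theorem eqOn_arcs_of_cutoff {V₀ : EuclideanSpace ℝ (Fin 3) → EuclideanSpace ℝ (Fin 3)} (hV₀ : ContDiff ℝ 1 V₀) {K₀ : ℝ}
    (hK₀ : ∀ y, ‖fderiv ℝ V₀ y‖ ≤ K₀) {Z₁ Z₂ : ℝ → EuclideanSpace ℝ (Fin 3)} {σ : ℝ}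
    (h1 : ∀ t ∈ Icc 0 σ, HasDerivAt Z₁ (-(selfSimilarTransport γ 0 V₀ (Z₁ t))) t)
    (h2 : ∀ t ∈ Icc 0 σ, HasDerivAt Z₂ (-(selfSimilarTransport γ 0 V₀ (Z₂ t))) t) (h0 : Z₁ 0 = Z₂ 0) :
    EqOn Z₁ Z₂ (Icc 0 σ) := by
  have hL := C2.Kelvin.lipschitzWith_selfSimilarTransport (γ := γ) hV₀ hK₀
  have hLneg : LipschitzWith (Real.toNNReal (|γ| + K₀)) (fun z => (-1 : ℝ) • selfSimilarTransport γ 0 V₀ z) :=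
    LipschitzWith.of_dist_le_mul fun a b => by
      rw [neg_one_smul, neg_one_smul, dist_neg_neg]
      exact hL.dist_le_mul a b
  have hc1 : ContinuousOn Z₁ (Icc 0 σ) := fun t ht => (h1 t ht).continuousAt.continuousWithinAt
  have hc2 : ContinuousOn Z₂ (Icc 0 σ) := fun t ht => (h2 t ht).continuousAt.continuousWithinAt
  refine ODE_solution_unique (v := fun _ z => (-1 : ℝ) • selfSimilarTransport γ 0 V₀ z) (fun _ => hLneg)
    hc1 (fun t ht => ?_) hc2 (fun t ht => ?_) h0
  · have h := h1 t (Ico_subset_Icc_self ht)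
    rw [← neg_one_smul ℝ (selfSimilarTransport γ 0 V₀ (Z₁ t))] at h
    exact h.hasDerivWithinAt
  · have h := h2 t (Ico_subset_Icc_self ht)
    rw [← neg_one_smul ℝ (selfSimilarTransport γ 0 V₀ (Z₂ t))] at h
    exact h.hasDerivWithinAt

end LastExit

end Summit.NavierStokesRegularity.NavierStokesRegularity.Theorems.PowerGaugeEulerLiouville

end
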